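import Summits.QuantumFields.QCD.Theses.SpectralDefectExtinction
import Literature.MathematicalPhysics.QuantumFieldTheory.QCDPhaseQuenched
import Literature.MathematicalPhysics.QuantumFieldTheory.SpectralDefectDensity
import Literature.Barriers.QuantumFields.WilsonDeterminantMassSplitting
import Summits.QuantumFields.QCD.Theorems.SpectralDefectExtinctionWegnerEstimateReduction
import Summits.QuantumFields.QCD.Theorems.SpectralDefectExtinctionWegnerEstimateStubCircleZeroCount
import Summits.QuantumFields.QCD.Theorems.SpectralDefectExtinctionWegnerEstimateStubResolventLocalSpectralSum
import Summits.QuantumFields.QCD.Theorems.SpectralDefectExtinctionWegnerEstimateCoareaHellmannFeynman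
import Summits.QuantumFields.QCD.Theorems.SpectralDefectExtinctionWegnerEstimateCoareaCircleShape
import Summits.QuantumFields.QCD.Theorems.SpectralDefectExtinctionWegnerEstimateCoareaSu3Circles
import Summits.QuantumFields.QCD.Theorems.SpectralDefectExtinctionWegnerEstimateCoareaRankMultiplicity
import Summits.QuantumFields.QCD.Theorems.SpectralDefectExtinctionWegnerEstimateCoareaTubeSum
import Summits.QuantumFields.QCD.Theorems.SpectralDefectExtinctionWegnerEstimateStubCoareaWegner
import Summits.QuantumFields.QCD.Theorems.SpectralDefectExtinctionWegnerEstimateSketchDefs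
import Summits.QuantumFields.QCD.Theorems.SpectralDefectExtinctionWegnerEstimateStubPortContinuous
import Summits.QuantumFields.QCD.Theorems.SpectralDefectExtinctionWegnerEstimateStubPortRigidity
import Summits.QuantumFields.QCD.Theorems.SpectralDefectExtinctionWegnerEstimateStubEnvContinuous
import Summits.QuantumFields.QCD.Theorems.SpectralDefectExtinctionWegnerEstimateStubStarRigidity
import Summits.QuantumFields.QCD.Theorems.SpectralDefectExtinctionWegnerEstimateStubCoareaWegnerFrom
import Summits.QuantumFields.QCD.Theorems.SpectralDefectExtinctionWegnerEstimateBadStarLocality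

/-!
# Line `Sketch` (skeleton "ResolventCell", RESHAPED gen 2: COAREA / CURRENT RIGIDITY) for crux
`SpectralDefectExtinction.WegnerEstimate` (item stmt-QuantumFields-8966) — LEAD'S SKELETON
(prover-line-stmt-QuantumFields-8966-c2-0, continuation of …-8966-0 (gen 0) and …-8966-c1-0 (gen 1), 2026-08-17).

State inherited.  The crux is `wegnerEstimate_of_localHaarWegner h` (LANDED p91808,
`Theorems/SpectralDefectExtinctionWegnerEstimateReduction.lean`) for `h` = the local Haar–Wegner lemma with frozen
GENUINE exterior: `∃ R C, ∀ L ≥ 2, x, U, m₀ ∈ [−1,0], ε ∈ (0,1]: E_V t_x(glue_{x,R}(U,V); m₀, ε) ≤ C`, where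
`t_x = Σ_{a,α} Im((Γ₅D_W − iε)⁻¹)_{(x,a,α),(x,a,α)}` and `V` re-randomises (product Haar) the links based in the cube
`x + box 4 R`.  Gen 0 promoted that stub; gen 1 replaced the sup over exteriors by ABSTRACT dissipative collar data
on small tori (`stub_cellWegner`, exterior elimination, 6 plumbing stubs landed p117653–p119335, composition p119522)
and found the abstract class FALSE at `R = 1` (star-vertex cancellation p94448 / numerics N1, N5): abstract boundary
data are an adversary no anti-concentration technology controls.

This reshape goes back to the GENUINE-exterior statement (hypothesis of p91808, verbatim) and cuts it along the one
published Wegner mechanism that needs NO monotone spectral variable — currents as level velocities (Erdős–Hasler,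
Ann. Henri Poincaré 13 (2012) 1719 = arXiv:1101.2139, §3) — in FIRST-order form (their second-order form squares the
local weight and costs a volume factor):

  E_V Σ_j m_j φ_ε(λ_j) ≤ c₀⁻¹ Σ_d E_V [ bad^{-k} Σ_j |J_d(ψ_j)| φ_ε(λ_j) ]      (rigidity, ℓ¹ over directions d = (e, X_i))
                     = c₀⁻¹ Σ_d E_V (1/2π) ∫₀^{2π} bad(V_t)^{-k} Σ_j |λ_j′(t)| φ_ε(λ_j(t)) dt   (right-invariance of Haar
                       under V ↦ V[e ↦ V(e)c_i(t)], Tonelli, Hellmann–Feynman λ_j′ = J_d(ψ_j))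
                     ≤ c₀⁻¹ Σ_d E_V [(min_g bad(V[e↦g]))^{-k}] · (crossings per circle) · π/(2π)

with `m_j` = mass of the j-th eigenvector on `x + box R'` (≥ its weight at `x`), `φ_ε(E) = ε/(E²+ε²)`, `∫φ_ε = π`, and
`∫₀^{2π} Σ_j|λ_j′|φ_ε(λ_j) dt = ∫ φ_ε(E) N(E) dE` (1-D area formula on monotone pieces).  Inputs:
* CROSSINGS PER CIRCLE — free and uniform in L: along the closed circle `V_e ↦ V_e c_i(t)` of ONE link, `H` moves in a
  rank-24 block affine in (cos t, sin t), so `t ↦ det(H − E)` has ≤ 48 zeros (`stub_circleZeroCount`, LANDED p134960;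
  bridge `coareaWegner_oneLinkCircle_detShape` p136155, circles p136162) and each crossing has multiplicity ≤ 24 off
  the finitely many flat levels (bridge p136473) ⇒ `N(E) ≤ 1152`;
* LEVEL VELOCITY vs LOCAL MASS (the bet): `Σ_d |J_d(ψ)| ≥ c₀ · bad(V|cell)^k · m_{R'}(ψ)` for every eigenvector with
  `|λ| ≤ 1` (`stub_currentRigidity`), with an exceptional set `{bad = 0}` whose single-link saturations have Haar
  measure `≤ C_B δ^m`, `m > k`, so that `E[(min_g bad)^{-k}] ≤ 1 + C_B k/(m−k)` (tube sum, bridge p136589);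
* `t_x = Σ_j w_j(x) φ_ε(λ_j)`, `w_j ≤ m_j` (`stub_resolventLocalSpectralSum`, LANDED p135064); Hellmann–Feynman current
  identity (bridge p135597, certifies the current formula in the signatures below).
The abstract analysis is ONE stub, `stub_coareaWegner`, stated as the implication
`circleZeroCount → resolventLocalSpectralSum → currentRigidity → localHaarWegner` (all four written out verbatim), so
the composition below is sorry-free by application and every piece of mathematics sits in exactly one stub:

* `stub_circleZeroCount` — matrix algebra.  LANDED p134960.
* `stub_resolventLocalSpectralSum` — spectral theorem.  LANDED p135064.
* `stub_coareaWegner` — 1-D analysis along one-link circles: TRUE (paper proof in Lines/Sketch.md §gen 2).  Lean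
  needs, beyond the landed bridges: ordered eigenvalues of a trigonometric Hermitian family are Lipschitz (Weyl) and
  real-analytic off the finitely many zeros of the discriminant (implicit function theorem + Jacobi's formula give
  `λ_j′ = ⟨u_j, H′u_j⟩` at simple points), piecewise monotone (finitely many critical points by a resultant count), and
  the 1-D change of variables on monotone pieces; the permanently degenerate case (discriminant ≡ 0) by a generic
  diagonal perturbation `H + ηD`, `η → 0`.  Elementary but long; Rellich–Kato (Kato II §6 Thm 6.1) would shortcut it.
* `stub_currentRigidity` — THE BET: deterministic current/mass rigidity of near-zero Wilson–Dirac modes.  Local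
  reformulation (Lines/Sketch.md): genuine eigenvectors restricted to `B_{R+1}(x)` are exactly (in the closure) the
  PORT-ADMISSIBLE fields (full equation on `B_R`, port-projected equation on the face sites of layer `R+1`); with
  `bad(W) := min {Σ_d |J_d(ψ)| + ‖T_λ(W)ψ‖² : |λ| ≤ 1, ‖ψ‖_{B_{R+1}} = 1}` the rigidity inequality holds TAUTOLOGICALLY
  with `c₀ = 1, k = 1` and all content is the saturated small-ball bound `Haar{min_g bad(W[e₀↦g]) < δ} ≤ C_B δ^m`,
  `m > 1`, i.e. codimension of the bad variety `{bad = 0}` vs the Łojasiewicz exponent of `bad`; equation count: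
  port-admissible currentless fields exist generically for `R ≤ 3` and NOT for `R ≥ 4` (excess 53 248 equations at
  `R = 4`), so `R = 4` is the intended radius.  FALSE for abstract collar data at small R (N1/N5: V-independent kernels
  are currentless at generic V) — this line states it for GENUINE configurations only.  Numerics N7 (kit j021686/
  j021687, direct minimisation of (ΣJ² + ‖Tψ‖²‖ψ‖²)/mass² at R = 1…4, port vs abstract) attach to the item when done.

GEN 2c (same day): `stub_currentRigidity` is DERIVED from the junk-free port min-functional `badPort R` (gen 2b's
`badR` turned out identically zero — outer-layer junk): the rigidity inequality is tautological for `bad := badPort R`,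
`R' = R − 1` (`stub_portRigidity`, provable), `badPort` is continuous and `≥ 0` (`stub_portContinuous`, provable), and
THE BET is the saturated Haar small-ball estimate `stub_portSmallBall` (`m > 1`; intended `R = 3`).
Crux ⟸ stub_portSmallBall alone.

GEN 3 (lead c3, 2026-08-17): `stub_portSmallBall` is FALSE — `badPort R ≡ 0` for EVERY `R` (collective 2-edge
junk: two 2-edge sites sharing an inward face carry 24 complex unknowns against 18 port equations, with no current
and no interior residual; explicit kernel `c ⊗ s`, `−(W(f₁,2)⁻¹W(f₁,1)c) ⊗ s`, `s` the `+1` eigenvector of `γ₀`;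
kernel-checked: `badPort_eq_zero`, `not_portSmallBall`, files `…BadPortJunkGeometry` / `…BadPortVanishes` over the
gen-3 section of `…SketchDefs`).  More generally EVERY compact local min-functional normalised on its own domain
vanishes identically (any equation-free boundary stratum hosts collective junk), so the gen-2c decomposition is
withdrawn and the open stub is again `stub_currentRigidity` itself (∃ an admissible `bad`): its honest content is
a rigidity functional normalised by INTERIOR mass (`box R'`, `R' ≤ R − 1`; non-compact variational problem —
continuity not automatic) plus its saturated Haar small-ball estimate with `m > 1`.  Numerics N9 (kit j024535 /
j024536) test whether port-admissible currentless fields WITH interior mass exist for Haar-generic data at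
`R = 2, 3` (existence for all `R` would kill the mechanism, not just the functional).
Crux ⟸ stub_currentRigidity alone (1 sorry); `stub_portContinuous` / `stub_portRigidity` stay landed but idle.

GEN 4 (lead c4, 2026-08-17): `stub_currentRigidity` is DERIVED again, from an explicit witness that is neither compact
(so it escapes the boundary junk that killed `badR`/`badPort`: face-sharing 2-edge pairs of the NEGATIVE corner host a
12-dimensional residual-free currentless family for every datum, but with zero INTERIOR mass) nor merely semicontinuous
(c3's objection): `bad := badEnv R R'`, the McShane/Lipschitz ENVELOPE (for the `ℓ¹` link cost on `box (R+1)`) of the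
INTERIOR-normalised min-functional `badStar R R' = inf {currentSum + residualSq : mass on box R' = 1}` (gen-2b ball
vocabulary; Defs appended, p155402).  Three provable stubs — `stub_envContinuous` (the envelope is `1`-Lipschitz for
`linkCost`, hence continuous, and `≥ 0`; LANDED p161078), `stub_starRigidity` (tautological: the pull-back of a genuine
eigenvector has zero cube residual; LANDED p161037), and the minorant property `badEnv ≤ badStar`
(landed with the Defs) — reduce the crux to ONE bet, `stub_envSmallBall`: the saturated Haar small-ball estimate with
exponent `m > 1` for the continuous function `badEnv R R'` (intended `(R, R') = (2, 1)`: junk-corrected equation count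
`+6376` at `R = 2`, i.e. generically NO interior-massive residual-free currentless field — numerics N10, kit, attached to
the item).  Since `{badEnv < δ} ⊂ δ-tube of {badStar < δ}`, the bet is the Łojasiewicz-exponent-versus-codimension
question for `badStar` near its zero set `Z ⊇ {flat} ∪ {colour-reducible with flat abelian part}` (codimension in the
tens of thousands); the HÖLDER crux follows from ANY exponent `m > 0` (landed Hölder branch p147521/p147831) and hence
from classical semialgebraic geometry once `Z_sat` is a proper algebraic subset (one certified generic-rank computation).
Crux ⟸ stub_envSmallBall alone (1 sorry; everything else of the line is LANDED).

GEN 4b/4c (lead c4, same day): the bet SPLIT BY REGIME and the small tori DECOUPLED from the `badStar` machinery.  The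
coarea route is pointwise in `L`, so its ranged form `stub_coareaWegnerFrom L₀` (LANDED p162933: verbatim p145270 with
`L ≥ L₀` and explicit radius/rigidity data) turns [`stub_envContinuous` ∧ `stub_starRigidity` ∧ `stub_envSmallBallLarge`]
into the local lemma for the THERMODYNAMIC tori `L ≥ 2R+3` (the window `box (R+1)` injects into the torus; the pull-back read
by `badEnv` is generic window data, and by the landed locality `badEnv_glue_indep` (p162711) it depends on the cell links
only), while the finitely many SMALL tori `2 ≤ L < 2R+3` (Disproof's toron corner; at `L ≤ 2R+1` the cell is the whole
torus) get their own stub `stub_smallTorusWegner`: the local lemma itself restricted to small tori — a fixed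
finite-dimensional Wegner estimate per torus, to be proven by ANY finite-dimensional means (no periodic pull-backs, no
`badStar`).  Composition: `localHaarWegner` by cases on `2R+3 ≤ L`.  Open stubs: `stub_envSmallBallLarge` (ε-net / forcing /
block anti-concentration architecture, Lines/Sketch.md §GEN 4b) and `stub_smallTorusWegner`.

Disproof.lean v9 (re-read 2026-08-17T10:20Z, lead c4: unchanged): no `-- Targets` on this line; (a) `ε > 0` only load-bearing — all stubs
at `ε > 0` or ε-free; (b) `p ≥ 1/4` — spent in the landed `stub_cellAverageBound`; the cell family is β-free; (c) the
tangency mechanism (`λ = f²` along a hypersurface ⇒ `ε^{1/2}`) is EXCLUDED by `stub_currentRigidity` wherever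
`bad > 0` (a tangential zero has `∇λ = 0` with mass) and priced by the tube sum near `{bad = 0}`.
-/

noncomputable section

namespace Summit.QuantumFields.QCD.Cruxes.WegnerEstimate.ResolventCell

open MeasureTheory
open scoped Matrix BigOperators
open Literature.MathematicalPhysics.QuantumLattice Literature.MathematicalPhysics.QuantumFieldTheory
  Literature.Probability.LatticeModels
open Summit.QuantumFields.QCD.Theses.SpectralDefectExtinction (WegnerEstimate)
open Matrix
open scoped ComplexOrder

/-! ## The stubs -/

/-! ### Landed stubs and bridges of this reshape (imported above; all in this namespace, all `--supports stmt-QuantumFields-8966`)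

* `stub_circleZeroCount` — Theorems/SpectralDefectExtinctionWegnerEstimateStubCircleZeroCount.lean (p134960)
* `stub_resolventLocalSpectralSum` — …StubResolventLocalSpectralSum.lean (p135064)
* bridges toward `stub_coareaWegner`: `coareaWegner_hellmannFeynman` (…CoareaHellmannFeynman.lean, p135597),
  `coareaWegner_oneLinkCircle_detShape` (…CoareaCircleShape.lean, p136155), `coareaWegner_su3Circles`
  (…CoareaSu3Circles.lean, p136162), `coareaWegner_oneLink_rank_le` / `_eigenvalue_mult_le` (…CoareaRankMultiplicity.lean,
  p136473), `coareaWegner_lintegral_rpow_neg_le` (…CoareaTubeSum.lean, p136589).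

* `stub_coareaWegner` — Theorems/SpectralDefectExtinctionWegnerEstimateStubCoareaWegner.lean (p145270; the 1-D route
  assembled from bridges CoareaSlice p137765, CoareaBookkeeping p138115, CoareaClusterDerivative p138406,
  CoareaWeylLipschitz p138603, CoareaIndicatrix p138904, CoareaCircleAffine p139027, CoareaLevelCount p139222,
  CoareaCircleMajorant p139880, CoareaCore p140792, CoareaCircleArea p142355, CoareaTransport p144784).

Only `stub_currentRigidity` below is open: the crux is kernel-reduced to it. -/

/-! ### Gen 2c (WITHDRAWN in gen 3): the port functional `badPort` — `stub_portContinuous` LANDED p148085,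
`stub_portRigidity` LANDED p148093, but `stub_portSmallBall` is FALSE (`badPort R ≡ 0`, lead c3: `badPort_eq_zero`,
`not_portSmallBall`).  The open stub is `stub_currentRigidity` below. -/

/-! ### Gen 4 (lead c4): the envelope witness — three provable stubs and ONE bet -/

/-! #### Landed gen-4 stubs (imported above, both `--supports stmt-QuantumFields-8966`, lead c4)

* `stub_envContinuous : ∀ R R', Continuous (badEnv R R') ∧ ∀ w, 0 ≤ badEnv R R' w` —
  Theorems/SpectralDefectExtinctionWegnerEstimateStubEnvContinuous.lean (p161078): the envelope is `1`-Lipschitz for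
  `linkCost` (`envContinuous_abs_badEnv_sub_le`), hence continuous; also the tube inclusion
  `envContinuous_sublevel_subset_tube : {badEnv < δ} ⊆ {w | ∃ w', badStar w' < δ ∧ linkCost R w w' < δ}`.
* `stub_starRigidity : ∀ R R', R' ≤ R → … → badStar R R' (glue read around x) * boxMass ψ (x + box R') ≤ Σ_cell |J(ψ)|` —
  Theorems/SpectralDefectExtinctionWegnerEstimateStubStarRigidity.lean (p161037): tautology of the infimum
  (`starRigidity_of_le` for an arbitrary configuration, `R' ≤ R + 1`).

Open (gen 4c): `stub_envSmallBallLarge` (thermodynamic small ball) and `stub_smallTorusWegner` (small tori). -/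

/-- **Stub `envSmallBallLarge` — THE BET, thermodynamic regime (gen 4b).**  There are radii `R' + 1 ≤ R`, `R ≥ 2`
(interior normalisation strictly inside the cube, where no boundary junk has mass; `R = 1` is excluded — `badStar 1 0 ≡ 0`
by c2's 40-dimensional star family), an exponent
`m > 1` and a constant `C_B` such that for every torus of side `L ≥ 2R + 3` (the window `box (R+1)` around `x` then
INJECTS into the torus, so the pull-back read by `badEnv R R'` is GENERIC window data: the cell links `V`, nothing
periodic), every centre `x`, exterior `U`, link `e₀` and `δ ∈ (0, 1]`, the product-Haar measure of the cell
configurations `V` movable by ONE link into `{badEnv R R' (glue read around x) < δ}` is `≤ C_B δ^m`.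
Proof architecture (Lines/Sketch.md §gen 4b, the lead's recommendation): ε-NET over the odd-sublattice values of a
candidate field + FORCING of the even values by the even residuals + PRODUCT (over the link-disjoint even-site blocks
of 8 links) of Haar anti-concentration for the 56 = 64 − 8 block currents; nominal exponent
`16(2R+1)³(2R−5) − 8`, positive from `R = 3`, ≈ 35 000 at `R = 4`; the open part is the compressible / multi-scale
bookkeeping (fields decaying through the amplitude window `δ^{1/2} < ρ < δ^{4/11}`). -/
theorem stub_envSmallBallLarge :
    ∃ (R R' : ℕ) (m C_B : ℝ), R' + 1 ≤ R ∧ 2 ≤ R ∧ 1 < m ∧ 0 < C_B ∧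
      ∀ (L : ℕ) [NeZero L], 2 * R + 3 ≤ L → ∀ (x : TorusSite 4 L) (U : GaugeConfig 4 L SU3) (e₀ : Edge 4 L) (δ : ℝ),
        0 < δ → δ ≤ 1 →
        (Measure.pi fun _ : Edge 4 L => haarProbability SU3)
            {V : GaugeConfig 4 L SU3 | ∃ g : SU3,
              badEnv R R' (fun l => (fun e : Edge 4 L => if (∃ y ∈ box 4 R, e.1 = x + Torus.proj L y) then
                  Function.update V e₀ g e else U e) (x + Torus.proj L l.1, l.2)) < δ} ≤
          ENNReal.ofReal (C_B * δ ^ m) := by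
  sorry

/-- **Stub `smallTorusWegner` — the SMALL-TORUS regime (gen 4c).**  For every cube radius `R` there is a constant `C`
such that on each of the finitely many tori `2 ≤ L < 2R + 3` the local Haar–Wegner lemma holds as stated: the product-Haar
average over the links based in `x + box R` (at `L ≤ 2R+1` this is EVERY link of the torus; at `L = 2R+2` one hyperplane
layer of the exterior `U` stays frozen) of the site-local resolvent trace `t_x = Σ_{a,α} Im((Γ₅D_W − iε)⁻¹)_{(x,a,α),(x,a,α)}` is
`≤ C`, uniformly in `x`, the exterior, `m₀ ∈ [−1,0]`, `ε ∈ (0,1]`.  Each instance is a FIXED finite-dimensional Wegner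
estimate (Haar-averaged local density of states of the Hermitian Wilson–Dirac operator on `L⁴` bounded at energy `0`):
the balance principle (level spread under re-randomisation ≥ its weight at `x`) with no thermodynamic uniformity; its
enemy is Disproof's toron corner (near-flat connections on `2⁴`: 12 modes at `±|θ|/2`, Haar-small but resonant).  Provable
torus by torus by finite-dimensional singularity analysis of the eigenvalue branches on `SU(3)^{4L⁴}`, or by the coarea
route with ANY admissible rigidity functional on the small torus; stated here free of that choice. -/
theorem stub_smallTorusWegner : ∀ R : ℕ, ∃ C : ℝ, 0 < C ∧ ∀ (L : ℕ) [NeZero L], 2 ≤ L → L < 2 * R + 3 →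
      ∀ (x : TorusSite 4 L) (m₀ ε : ℝ), -1 ≤ m₀ → m₀ ≤ 0 → 0 < ε → ε ≤ 1 →
      ∀ U : GaugeConfig 4 L SU3,
        ∫ V, (∑ a : Fin 3, ∑ α : Fin 4,
          (((spinorLift gammaFive * wilsonDirac (fundamentalRep (Fin 3))
              (fun e => if (∃ y ∈ box 4 R, e.1 = x + Torus.proj L y) then V e else U e) m₀ 1 -
            ((ε : ℂ) * Complex.I) • (1 : Matrix (QuarkIdx L) (QuarkIdx L) ℂ))⁻¹ :
              Matrix (QuarkIdx L) (QuarkIdx L) ℂ) (x, a, α) (x, a, α)).im)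
          ∂(Measure.pi fun _ : Edge 4 L => haarProbability SU3) ≤ C := by
  sorry

/-- **The local Haar–Wegner lemma on the THERMODYNAMIC tori `L ≥ 2R+3`** (gen 4c), DERIVED: the ranged coarea route
`stub_coareaWegnerFrom (2R+3)` (p162933) fed with the envelope witness — `bad := badEnv R R'`, `k = c₀ = 1`, continuity
`stub_envContinuous` (p161078), rigidity `stub_starRigidity` through the minorant `badEnv ≤ badStar` (p161037), and the open
small ball `stub_envSmallBallLarge`. -/
theorem localHaarWegner_large :
    ∃ R : ℕ, ∃ C : ℝ, 0 < C ∧ ∀ (L : ℕ) [NeZero L], 2 * R + 3 ≤ L →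
      ∀ (x : TorusSite 4 L) (m₀ ε : ℝ), -1 ≤ m₀ → m₀ ≤ 0 → 0 < ε → ε ≤ 1 →
      ∀ U : GaugeConfig 4 L SU3,
        ∫ V, (∑ a : Fin 3, ∑ α : Fin 4,
          (((spinorLift gammaFive * wilsonDirac (fundamentalRep (Fin 3))
              (fun e => if (∃ y ∈ box 4 R, e.1 = x + Torus.proj L y) then V e else U e) m₀ 1 -
            ((ε : ℂ) * Complex.I) • (1 : Matrix (QuarkIdx L) (QuarkIdx L) ℂ))⁻¹ :
              Matrix (QuarkIdx L) (QuarkIdx L) ℂ) (x, a, α) (x, a, α)).im)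
          ∂(Measure.pi fun _ : Edge 4 L => haarProbability SU3) ≤ C := by
  obtain ⟨R, R', m, C_B, hR'1, _hR2, hm, hCB, hlarge⟩ := stub_envSmallBallLarge
  have hR' : R' ≤ R := Nat.le_of_succ_le hR'1
  obtain ⟨C, hC, h⟩ := stub_coareaWegnerFrom (2 * R + 3) R R' 1 m 1 C_B (by exact_mod_cast hm) one_pos hCB
    (badEnv R R') (stub_envContinuous R R').1 (stub_envContinuous R R').2
    stub_circleZeroCount stub_resolventLocalSpectralSum hlarge
    (fun L _ hL x m₀ hm₀ hm₀' U V ψ lam hlam hψ => by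
      have h2 : 2 ≤ L := le_trans (by omega) hL
      have h := stub_starRigidity R R' hR' L h2 x m₀ hm₀ hm₀' U V ψ lam hlam hψ
      refine le_trans ?_ h
      rw [one_mul, pow_one]
      exact mul_le_mul_of_nonneg_right (badEnv_le_badStar R R' _) (boxMass_nonneg _ _))
  exact ⟨R, C, hC, h⟩

/-! ## Composition (sorry-free): the local lemma by application, then the crux by name -/

/-- **The local Haar–Wegner lemma with frozen genuine exterior** (verbatim the hypothesis of the landed
`wegnerEstimate_of_localHaarWegner`, p91808; = gen-0 `stub_localHaarWegner`), DERIVED (gen 4c) by cases on the torus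
size: `localHaarWegner_large` for `L ≥ 2R+3`, `stub_smallTorusWegner R` for `2 ≤ L < 2R+3`, constant `max C₁ C₂`. -/
theorem localHaarWegner :
    ∃ R : ℕ, ∃ C : ℝ, 0 < C ∧ ∀ (L : ℕ) [NeZero L], 2 ≤ L →
      ∀ (x : TorusSite 4 L) (m₀ ε : ℝ), -1 ≤ m₀ → m₀ ≤ 0 → 0 < ε → ε ≤ 1 →
      ∀ U : GaugeConfig 4 L SU3,
        ∫ V, (∑ a : Fin 3, ∑ α : Fin 4,
          (((spinorLift gammaFive * wilsonDirac (fundamentalRep (Fin 3))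
              (fun e => if (∃ y ∈ box 4 R, e.1 = x + Torus.proj L y) then V e else U e) m₀ 1 -
            ((ε : ℂ) * Complex.I) • (1 : Matrix (QuarkIdx L) (QuarkIdx L) ℂ))⁻¹ :
              Matrix (QuarkIdx L) (QuarkIdx L) ℂ) (x, a, α) (x, a, α)).im)
          ∂(Measure.pi fun _ : Edge 4 L => haarProbability SU3) ≤ C := by
  obtain ⟨R, C₁, hC₁, hbig⟩ := localHaarWegner_large
  obtain ⟨C₂, hC₂, hsmallT⟩ := stub_smallTorusWegner R
  refine ⟨R, max C₁ C₂, lt_max_of_lt_left hC₁, ?_⟩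
  intro L _ hL x m₀ ε hm₀ hm₀' hε hε1 U
  by_cases hLR : 2 * R + 3 ≤ L
  · exact (hbig L hLR x m₀ ε hm₀ hm₀' hε hε1 U).trans (le_max_left _ _)
  · exact (hsmallT L hL (Nat.lt_of_not_le hLR) x m₀ ε hm₀ hm₀' hε hε1 U).trans (le_max_right _ _)

/-- **The skeleton IS the crux proof modulo the four declared stubs.**  `WegnerEstimate_of` concludes
`SpectralDefectExtinction.WegnerEstimate` BY NAME: the derived local lemma `localHaarWegner` fed to the landed
resolvent–cell reduction `wegnerEstimate_of_localHaarWegner` (p91808; itself built on the landed stubs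
`stub_countLeResolvent`, `stub_localTraceRegular`, `stub_glueHaar`, `stub_untilt`, `stub_cellAverageBound`). -/
theorem WegnerEstimate_of : WegnerEstimate :=
  wegnerEstimate_of_localHaarWegner localHaarWegner

end Summit.QuantumFields.QCD.Cruxes.WegnerEstimate.ResolventCell

end
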